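import Summits.KontsevichZagierPeriods.KontsevichZagierPeriods.Theorems.ValuedFieldSpecialisationClassLevelExpansionFibreDimOneFibreSubst

/-!
# Route ValuedFieldSpecialisation — fibrewise substitutions with a Jacobian vanishing on the edge

Helper for item stmt-KontsevichZagierPeriods-3503 (`ClassLevelExpansionFibreDimOne`). The variants of
`of_sub_of_mem_fibredRelations_fibreSubst` / `exists_fibreSubst_pullback` (`…FibreSubst`) in which
the derivative `∂ψ/∂t` is only required to be NONNEGATIVE on the closed band (it may vanish on the
edge, as for the power map `t = ω^q` at `ω = 0`); strict monotonicity of `t ↦ ψ(y, t)` is kept, so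
the substitution is still injective and the change-of-variables formula
(`MeasureTheory.integral_image_eq_integral_abs_det_fderiv_smul`, which needs no non-vanishing
Jacobian) applies verbatim. Source: M. Kontsevich, D. Zagier (2001), §1.2, rule (2).
-/

noncomputable section

namespace Summit.KontsevichZagierPeriods.ValuedFieldSpecialisation

open MeasureTheory Set Filter Function
open scoped Topology
open Literature.NumberTheory.Transcendental Literature.NumberTheory.Transcendental.KZ
open Literature.ModelTheory.ExponentialFields (IsSemialgebraic)

/-- **Fibrewise substitutions along the last coordinate are fibred changes of variables.** See the
module docstring: for representations `r` on the band and `r'` on the image band with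
`r.integrand z = r'.integrand (Φ z) · ∂ψ/∂t (z)` (`∂ψ/∂t > 0` on the band),
`[r] − [r'] ∈ fibredRelations`. [Kontsevich–Zagier 2001, §1.2, rule (2)] [folklore] -/
theorem of_sub_of_mem_fibredRelations_fibreSubst_of_nonneg {m : ℕ} {G : Set (Fin (m + 1) → ℝ)}
    {a b : (Fin (m + 1) → ℝ) → ℝ} (ha : IsSemialgebraicFunOn ℚ G a)
    (hb : IsSemialgebraicFunOn ℚ G b) (hab : ∀ y ∈ G, a y ≤ b y)
    {ψ : (Fin (m + 1 + 1) → ℝ) → ℝ} {U : Set (Fin (m + 1 + 1) → ℝ)} (hUo : IsOpen U)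
    (hBU : KZlog.band G a b ⊆ U) (hψsa : IsSemialgebraicFunOn ℚ (KZlog.band G a b) ψ)
    (hψd : DifferentiableOn ℝ ψ U)
    (hψnn : ∀ z ∈ KZlog.band G a b, 0 ≤ fderiv ℝ ψ z (Pi.single (Fin.last (m + 1)) 1))
    (hψmono : ∀ y ∈ G, StrictMonoOn (fun t : ℝ => ψ (Fin.snoc y t)) (Icc (a y) (b y)))
    (r r' : IntegralRep (m + 1 + 1)) (hr : r.domain = KZlog.band G a b)
    (hr' : r'.domain = KZlog.band G (fun y => ψ (Fin.snoc y (a y))) (fun y => ψ (Fin.snoc y (b y))))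
    (hint : ∀ z ∈ r.domain, r.integrand z =
      r'.integrand (Fin.snoc (Fin.init z) (ψ z)) * fderiv ℝ ψ z (Pi.single (Fin.last (m + 1)) 1)) :
    of r - of r' ∈ fibredRelations := by
  obtain ⟨Φ', hsa, hderiv, hinj, himg, hdet, h0⟩ :=
    fibreSubst_data ha hb hab hUo hBU hψsa hψd hψmono
  refine mem_fibredRelations_of_mem_fibredChangeOfVariablesRel
    ⟨m + 1, r, r', fun z => Fin.snoc (Fin.init z) (ψ z), Φ', hr ▸ hsa, fun z hz => ?_,
      hr ▸ hinj, by rw [hr', hr, himg], fun z hz => ?_, fun z _ => h0 z, rfl⟩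
  · rw [hr] at hz ⊢; exact hderiv z hz
  · rw [hint z hz, hdet, abs_of_nonneg (hψnn z (hr ▸ hz))]

/-- **Pulling a representation back along a fibrewise substitution.** With the data of the module
docstring, `∂ψ/∂t` `ℚ`-semialgebraic and positive on the band, and a representation `r'` on the
IMAGE band, there is a representation `r` on the band with integrand `r'.integrand (Φ z) · ∂ψ/∂t (z)`
(integrable by the change-of-variables formula
`MeasureTheory.integrableOn_image_iff_integrableOn_abs_det_fderiv_smul`), and
`[r] − [r'] ∈ fibredRelations`. [Kontsevich–Zagier 2001, §1.2, rule (2)] [folklore] -/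
theorem exists_fibreSubst_pullback_of_nonneg {m : ℕ} {G : Set (Fin (m + 1) → ℝ)}
    {a b : (Fin (m + 1) → ℝ) → ℝ} (ha : IsSemialgebraicFunOn ℚ G a)
    (hb : IsSemialgebraicFunOn ℚ G b) (hab : ∀ y ∈ G, a y ≤ b y)
    {ψ : (Fin (m + 1 + 1) → ℝ) → ℝ} {U : Set (Fin (m + 1 + 1) → ℝ)} (hUo : IsOpen U)
    (hBU : KZlog.band G a b ⊆ U) (hψsa : IsSemialgebraicFunOn ℚ (KZlog.band G a b) ψ)
    (hψd : DifferentiableOn ℝ ψ U)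
    (hψ'sa : IsSemialgebraicFunOn ℚ (KZlog.band G a b) (fun z => fderiv ℝ ψ z (Pi.single (Fin.last (m + 1)) 1)))
    (hψnn : ∀ z ∈ KZlog.band G a b, 0 ≤ fderiv ℝ ψ z (Pi.single (Fin.last (m + 1)) 1))
    (hψmono : ∀ y ∈ G, StrictMonoOn (fun t : ℝ => ψ (Fin.snoc y t)) (Icc (a y) (b y)))
    (r' : IntegralRep (m + 1 + 1))
    (hr' : r'.domain = KZlog.band G (fun y => ψ (Fin.snoc y (a y))) (fun y => ψ (Fin.snoc y (b y)))) :
    ∃ r : IntegralRep (m + 1 + 1), r.domain = KZlog.band G a b ∧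
      (r.integrand = fun z => r'.integrand (Fin.snoc (Fin.init z) (ψ z)) *
        fderiv ℝ ψ z (Pi.single (Fin.last (m + 1)) 1)) ∧
      of r - of r' ∈ fibredRelations := by
  obtain ⟨Φ', hsa, hderiv, hinj, himg, hdet, h0⟩ :=
    fibreSubst_data ha hb hab hUo hBU hψsa hψd hψmono
  have hBsa : IsSemialgebraic ℚ (KZlog.band G a b) := KZlog.isSemialgebraic_band ha hb
  have hBm : MeasurableSet (KZlog.band G a b) := IsSemialgebraic.measurableSet_holds hBsa
  -- semialgebraicity of the pulled-back integrand
  have hcomp : IsSemialgebraicFunOn ℚ (KZlog.band G a b)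
      (fun z => r'.integrand (Fin.snoc (Fin.init z) (ψ z))) :=
    IsSemialgebraicFunOn.comp_isSemialgebraicMapOn_holds r'.isSemialgebraicFunOn_integrand hsa
      (by rw [hr', ← himg]; exact mapsTo_image _ _)
  have hfsa := IsSemialgebraicFunOn.mul_holds hcomp hψ'sa
  -- integrability by the change-of-variables formula
  have hint : IntegrableOn (fun z => r'.integrand (Fin.snoc (Fin.init z) (ψ z)) *
      fderiv ℝ ψ z (Pi.single (Fin.last (m + 1)) 1)) (KZlog.band G a b) := by
    have h := (integrableOn_image_iff_integrableOn_abs_det_fderiv_smul volume hBm hderiv hinj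
      r'.integrand).mp (by rw [himg, ← hr']; exact r'.integrableOn)
    refine h.congr_fun (fun z hz => ?_) hBm
    simp only [smul_eq_mul, hdet, abs_of_nonneg (hψnn z hz)]
    ring
  refine ⟨⟨_, _, hBsa, hfsa, hint⟩, rfl, rfl, ?_⟩
  exact of_sub_of_mem_fibredRelations_fibreSubst_of_nonneg ha hb hab hUo hBU hψsa hψd hψnn hψmono _ r' rfl hr'
    fun z _ => rfl

end Summit.KontsevichZagierPeriods.ValuedFieldSpecialisation
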